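import Literature.AlgebraicGeometry.ModuliOfAbelianVarieties.SimilitudeRestrictionOfScalars
import Mathlib.RingTheory.Discriminant
import Mathlib.NumberTheory.NumberField.InfinitePlace.Embeddings
import HarnessLib

/-!
# Left eigenrows of a restriction of scalars (Deligne 1971, 4.9 «restriction des scalaires», complexified)

Topic `AlgebraicGeometry/ModuliOfAbelianVarieties`; namespace `Literature.AlgebraicGeometry.ModuliOfAbelianVarieties`
(sequel of ★ `SimilitudeRestrictionOfScalars`: `resMatrix b A`, the matrix of `x ↦ A·x` on `S^m` read `R`-linearly in the
basis `eᵢ ⊗ b_k`).  THEOREMS ONLY.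

When an `S`-linear operator `A ∈ M_m(S)` is read over `R` along an `R`-basis `b` of `S` and then base-changed along an
`R`-algebra map `R → C`, its LEFT eigenrows are read «embedding by embedding»: for every `R`-algebra map `φ : S → C`
and every row `c ∈ C^m`, the row `c ⊗ r_φ := ((j, l) ↦ c_j · φ(b_l))` satisfies

  `(c ⊗ r_φ) · res_b(A)_C = (c · φ(A)) ⊗ r_φ`            (`vecMul_resMatrix_map`),

so `c ⊗ r_φ` is a left `μ`-eigenrow of `res_b(A)_C` as soon as `c` is a left `μ`-eigenrow of the `m × m` matrix `φ(A)`
(`vecMul_resMatrix_map_of_vecMul_eq_smul`), and conversely (`vecMul_map_eq_smul_of_vecMul_resMatrix_map`, the rows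
`r_φ` being non-zero).  Rows attached to `C`-linearly independent `r_φ` and, for each `φ`, linearly independent `c`'s
are linearly independent (`linearIndependent_tensorRows`); for a number field `M/ℚ` and `C = ℂ` the rows
`r_σ = (σ(b_l))_l`, `σ : M →+* ℂ`, ARE linearly independent (`NumberField.linearIndependent_embeddingRows`: the matrix
`(σ(b_l))` has non-zero determinant, its square being the discriminant — Mathlib
`Algebra.discr_eq_det_embeddingsMatrixReindex_pow_two`, `Algebra.discr_not_zero_of_basis`).

Consumer: the complexified eigenrows of Deligne's `h_W(i)` on `(W₀ ⊕ V_M) ⊗ ℝ` read in a symplectic frame (cell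
hodgecm-mathlib, period chart of the unitary-to-Siegel embedding).

## References
* [Deligne1971TravauxShimura] P. Deligne, *Travaux de Shimura*, 4.9 p. 148 («restriction des scalaires»).
* [Milne2005ShimuraVarieties] J. S. Milne, *Introduction to Shimura varieties*, §8 p. 81.
-/

noncomputable section

open Matrix

namespace Literature.AlgebraicGeometry.ModuliOfAbelianVarieties

/-! ### §1. The row `c ⊗ r_φ` and its image under `res_b(A)` -/

section Rows

variable {R S C : Type} [CommRing R] [CommRing S] [Algebra R S] [CommRing C] [Algebra R C]
variable {κ : Type} [Fintype κ] [DecidableEq κ] {m : Type} [Fintype m] [DecidableEq m]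
variable (b : Module.Basis κ R S) (φ : S →ₐ[R] C)

omit [DecidableEq κ] in
/-- `φ(x · b_l)` expanded along the basis: `Σ_k φ(b_k) · (repr (x·b_l))_k = φ(x)·φ(b_l)`.
[cite: Deligne1971TravauxShimura, 4.9 p. 148] -/
theorem sum_map_repr_mul_basis (x : S) (l : κ) :
    ∑ k, φ (b k) * algebraMap R C (b.repr (x * b l) k) = φ x * φ (b l) := by
  have h : ∑ k, b.repr (x * b l) k • b k = x * b l := b.sum_repr (x * b l)
  have h2 : φ (∑ k, b.repr (x * b l) k • b k) = ∑ k, φ (b k) * algebraMap R C (b.repr (x * b l) k) := by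
    rw [map_sum]
    refine Finset.sum_congr rfl fun k _ => ?_
    rw [map_smul, Algebra.smul_def, mul_comm]
  rw [← h2, h, map_mul]

/-- **Left action of a restriction of scalars on the rows `c ⊗ r_φ`**: for an `R`-algebra map `φ : S → C`, a row
`c ∈ C^m` and `A ∈ M_m(S)`, `(c ⊗ r_φ) · res_b(A)_C = (c · φ(A)) ⊗ r_φ`, where `(c ⊗ r_φ)(j, l) = c_j φ(b_l)` and
`res_b(A)_C` is ★ `resMatrix b A` mapped to `C`. [cite: Deligne1971TravauxShimura, 4.9 p. 148] -/
theorem vecMul_resMatrix_map (A : Matrix m m S) (c : m → C) :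
    (fun p : m × κ => c p.1 * φ (b p.2)) ᵥ* (resMatrix b A).map (algebraMap R C) =
      fun p : m × κ => (c ᵥ* A.map φ) p.1 * φ (b p.2) := by
  funext ⟨j, l⟩
  simp only [vecMul, dotProduct, Matrix.map_apply, Fintype.sum_prod_type]
  calc ∑ i, ∑ k, c i * φ (b k) * algebraMap R C (resMatrix b A (i, k) (j, l))
      = ∑ i, c i * (φ (A i j) * φ (b l)) := by
        refine Finset.sum_congr rfl fun i _ => ?_
        rw [← sum_map_repr_mul_basis b φ (A i j) l, Finset.mul_sum]
        refine Finset.sum_congr rfl fun k _ => ?_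
        rw [resMatrix_apply, mul_assoc]
    _ = (∑ i, c i * φ (A i j)) * φ (b l) := by rw [Finset.sum_mul]; simp only [mul_assoc]

/-- **Eigenrows embedding by embedding**: if `c · φ(A) = μ c` then `c ⊗ r_φ` is a left `μ`-eigenrow of `res_b(A)_C`.
[cite: Deligne1971TravauxShimura, 4.9 p. 148] -/
theorem vecMul_resMatrix_map_of_vecMul_eq_smul (A : Matrix m m S) {c : m → C} {μ : C}
    (hc : c ᵥ* A.map φ = μ • c) :
    (fun p : m × κ => c p.1 * φ (b p.2)) ᵥ* (resMatrix b A).map (algebraMap R C) =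
      μ • fun p : m × κ => c p.1 * φ (b p.2) := by
  rw [vecMul_resMatrix_map, hc]
  funext p
  simp only [Pi.smul_apply, smul_eq_mul, mul_assoc]

/-- The converse: if `c ⊗ r_φ` is a left `μ`-eigenrow of `res_b(A)_C` and some `φ(b_l)` is a non-zero-divisor (e.g.
`C` a field and `φ ≠ 0` on the basis), then `c · φ(A) = μ c`. [cite: Deligne1971TravauxShimura, 4.9 p. 148] -/
theorem vecMul_map_eq_smul_of_vecMul_resMatrix_map [IsDomain C] (A : Matrix m m S) {c : m → C} {μ : C}
    {l : κ} (hl : φ (b l) ≠ 0)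
    (h : (fun p : m × κ => c p.1 * φ (b p.2)) ᵥ* (resMatrix b A).map (algebraMap R C) =
      μ • fun p : m × κ => c p.1 * φ (b p.2)) :
    c ᵥ* A.map φ = μ • c := by
  rw [vecMul_resMatrix_map] at h
  funext j
  have hj := congrFun h (j, l)
  simp only [Pi.smul_apply, smul_eq_mul] at hj
  rw [← mul_assoc] at hj
  exact mul_right_cancel₀ hl hj

end Rows

/-! ### §2. Linear independence of the rows `c ⊗ r_σ` -/

section Independence

variable {K : Type} [Field K] {ι κ m : Type}

/-- **Independence of tensor rows**: if the rows `r_σ ∈ K^κ` (`σ ∈ ι`) are linearly independent and, for each `σ`, the rows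
`c^{σ,t} ∈ K^m` (`t ∈ T_σ`) are linearly independent, then the rows `c^{σ,t} ⊗ r_σ = ((j,l) ↦ c^{σ,t}_j · r_σ(l))`,
`(σ, t) ∈ Σ_σ T_σ`, are linearly independent in `K^{m × κ}`. [cite: Deligne1971TravauxShimura, 4.9 p. 148] -/
theorem linearIndependent_tensorRows [Fintype ι] {T : ι → Type} [∀ σ, Fintype (T σ)] {r : ι → κ → K}
    (hr : LinearIndependent K r) {c : ∀ σ, T σ → m → K} (hc : ∀ σ, LinearIndependent K (c σ)) :
    LinearIndependent K (fun st : (Σ σ, T σ) => fun p : m × κ => c st.1 st.2 p.1 * r st.1 p.2) := by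
  classical
  rw [Fintype.linearIndependent_iff]
  intro a ha st
  -- evaluate the relation at `(j, l)` and regroup along `σ`
  have hjl : ∀ j l, ∑ σ, (∑ t, a ⟨σ, t⟩ * c σ t j) * r σ l = 0 := by
    intro j l
    have h := congrFun ha (j, l)
    simp only [Finset.sum_apply, Pi.smul_apply, smul_eq_mul, Pi.zero_apply] at h
    rw [Fintype.sum_sigma] at h
    rw [← h]
    refine Finset.sum_congr rfl fun σ _ => ?_
    rw [Finset.sum_mul]
    refine Finset.sum_congr rfl fun t _ => ?_
    ring
  -- independence of the `r_σ`: for each `j`, all coefficients `Σ_t a_{σ,t} c^{σ,t}_j` vanish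
  have hσ : ∀ σ j, ∑ t, a ⟨σ, t⟩ * c σ t j = 0 := by
    intro σ j
    have h := Fintype.linearIndependent_iff.1 hr (fun σ => ∑ t, a ⟨σ, t⟩ * c σ t j) (by
      funext l
      simp only [Finset.sum_apply, Pi.smul_apply, smul_eq_mul, Pi.zero_apply]
      exact hjl j l)
    exact h σ
  -- independence of the `c^{σ,t}`
  have h := Fintype.linearIndependent_iff.1 (hc st.1) (fun t => a ⟨st.1, t⟩) (by
    funext j
    simp only [Finset.sum_apply, Pi.smul_apply, smul_eq_mul, Pi.zero_apply]
    exact hσ st.1 j)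
  obtain ⟨σ, t⟩ := st
  exact h t

end Independence

/-! ### §3. The embedding rows of a number field are linearly independent -/

section NumberField

open NumberField

variable (M : Type) [Field M] [NumberField M] {κ : Type} [Fintype κ] [DecidableEq κ]

/-- **The rows `r_σ = (σ(b_l))_l`, `σ : M →+* ℂ`, are linearly independent over `ℂ`** for a `ℚ`-basis `b` of a number
field `M`: the square matrix `(σ_j(b_l))` has non-zero determinant since its square is the (non-zero) discriminant of `b`
(Mathlib `Algebra.discr_eq_det_embeddingsMatrixReindex_pow_two`, `Algebra.discr_not_zero_of_basis`).
[cite: Milne2005ShimuraVarieties, §8 p. 81] -/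
theorem linearIndependent_embeddingRows (b : Module.Basis κ ℚ M) :
    LinearIndependent ℂ (fun σ : M →+* ℂ => fun l : κ => σ (b l)) := by
  classical
  -- index the `ℚ`-algebra embeddings by `κ`
  have hcard : Fintype.card κ = Fintype.card (M →ₐ[ℚ] ℂ) := by
    rw [AlgHom.card ℚ M ℂ, Module.finrank_eq_card_basis b]
  let e : κ ≃ (M →ₐ[ℚ] ℂ) := Fintype.equivOfCardEq hcard
  have hdet : (Algebra.embeddingsMatrixReindex ℚ ℂ b e).det ≠ 0 := by
    intro h0
    have h := Algebra.discr_eq_det_embeddingsMatrixReindex_pow_two ℚ ℂ b e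
    rw [h0, zero_pow two_ne_zero, map_eq_zero] at h
    exact Algebra.discr_not_zero_of_basis ℚ b h
  -- the columns of `embeddingsMatrixReindex` are the rows `r_{e j}`; transpose to rows
  have hT : (Algebra.embeddingsMatrixReindex ℚ ℂ b e)ᵀ.det ≠ 0 := by rwa [det_transpose]
  have hrows := Matrix.linearIndependent_rows_of_det_ne_zero hT
  -- `(embeddingsMatrixReindex b e)ᵀ j l = (e j) (b l)`
  have hrow : (fun j : κ => (Algebra.embeddingsMatrixReindex ℚ ℂ b e)ᵀ j) =
      fun j : κ => fun l : κ => ((e j : M →ₐ[ℚ] ℂ) : M →+* ℂ) (b l) := by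
    funext j l
    simp [Algebra.embeddingsMatrixReindex, Algebra.embeddingsMatrix]
  rw [hrow] at hrows
  -- reindex from `κ` (via `e`) and from `ℚ`-algebra maps to ring maps
  let e' : κ ≃ (M →+* ℂ) := e.trans RingHom.equivRatAlgHom.symm
  have hcomp : (fun σ : M →+* ℂ => fun l : κ => σ (b l)) ∘ e' =
      fun j : κ => fun l : κ => ((e j : M →ₐ[ℚ] ℂ) : M →+* ℂ) (b l) := by
    funext j l
    rfl
  exact (linearIndependent_equiv e').1 (hcomp ▸ hrows)

end NumberField

end Literature.AlgebraicGeometry.ModuliOfAbelianVarieties
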